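import Literature.Analysis.OperatorTheory.KreinStewartCompression

/-!
# Kreĭn–Stewart definitization: the algebraic definitization theorem

`KreinStewart.abs_definitization`: on any complex vector space with a Hermitian form with at most
`κ` negative squares, every symmetric operator `T` admits a non-zero polynomial `P` of degree
`≤ κ` with `Re B (P(T)v) (P(T)v) ≥ 0` for all `v` (compactness of the coefficient sphere over the
directed family of finite sets, `KreinStewart.exists_poly_finset`). Also the normalised version
and the coefficient expansions used in the limit argument. See `KreinStewartDefs`.
-/

open scoped ComplexConjugate
open Module Polynomial

namespace Literature.Analysis.OperatorTheory.KreinStewart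

variable {V : Type*} [AddCommGroup V] [Module ℂ V] {B : HForm V}

/-- `toPoly c = 0 ↔ c = 0`. [folklore] -/
theorem toPoly_eq_zero_iff {κ : ℕ} (c : Fin (κ + 1) → ℂ) : toPoly c = 0 ↔ c = 0 := by
  rw [toPoly_eq, Submodule.coe_eq_zero, LinearEquiv.map_eq_zero_iff]

/-- `toPoly c` has degree at most `κ`. [folklore] -/
theorem natDegree_toPoly_le {κ : ℕ} (c : Fin (κ + 1) → ℂ) : (toPoly c).natDegree ≤ κ := by
  have h : (toPoly c).degree < ((κ + 1 : ℕ) : WithBot ℕ) := by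
    rw [toPoly_eq]
    exact mem_degreeLT.1 (SetLike.coe_mem _)
  by_cases h0 : toPoly c = 0
  · simp [h0]
  · rw [degree_eq_natDegree h0, Nat.cast_lt] at h
    omega

/-- The coefficients of `toPoly c` are the entries of `c`. [folklore] -/
theorem coeff_toPoly {κ : ℕ} (c : Fin (κ + 1) → ℂ) (j : Fin (κ + 1)) :
    (toPoly c).coeff j = c j :=
  congr_fun ((degreeLTEquiv ℂ (κ + 1)).apply_symm_apply c) j

/-- `toPoly` is linear (scalars). [folklore] -/
theorem toPoly_smul {κ : ℕ} (a : ℂ) (c : Fin (κ + 1) → ℂ) : toPoly (a • c) = Polynomial.C a * toPoly c := by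
  simp only [toPoly, Pi.smul_apply, smul_eq_mul, ← C_mul_monomial, ← Finset.mul_sum]

/-- `(toPoly c)(T) v = Σ_j c_j T^j v`. [folklore] -/
theorem aeval_toPoly_apply {κ : ℕ} (T : V →ₗ[ℂ] V) (c : Fin (κ + 1) → ℂ) (v : V) :
    aeval T (toPoly c) v = ∑ j : Fin (κ + 1), c j • (T ^ (j : ℕ)) v := by
  simp only [toPoly, map_sum, aeval_monomial, LinearMap.coe_sum, Finset.sum_apply,
    Module.End.mul_apply, Module.algebraMap_end_apply]

/-- The quadratic form `c ↦ Re B (P_c(T) v) (P_c(T) v)` is continuous in the coefficients.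
[folklore] -/
theorem continuous_quadForm {κ : ℕ} (T : V →ₗ[ℂ] V) (v : V) :
    Continuous fun c : Fin (κ + 1) → ℂ =>
      (B (aeval T (toPoly c) v) (aeval T (toPoly c) v)).re := by
  have hfun : (fun c : Fin (κ + 1) → ℂ => (B (aeval T (toPoly c) v) (aeval T (toPoly c) v)).re)
      = fun c => (∑ i : Fin (κ + 1), ∑ j : Fin (κ + 1),
          conj (c i) * c j * B ((T ^ (i : ℕ)) v) ((T ^ (j : ℕ)) v)).re := by
    funext c
    rw [aeval_toPoly_apply, apply_sum_smul]
    congr 1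
    refine Finset.sum_congr rfl fun i _ => ?_
    rw [apply_right_sum_smul, Finset.mul_sum]
    refine Finset.sum_congr rfl fun j _ => ?_
    ring
  rw [hfun]
  fun_prop

/-- **Algebraic definitization theorem.** On a complex vector space with a Hermitian form with at
most `κ` negative squares, every symmetric operator `T` admits a non-zero polynomial `P` of degree
at most `κ` such that the range of `P(T)` is a non-negative subspace. (Elementary
finite-dimensional compression + compactness replacement for Pontryagin's theorem.) [folklore] -/
theorem abs_definitization (hB : B.IsSymm) {T : V →ₗ[ℂ] V} (hT : IsSymOp B T) {κ : ℕ}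
    (h : NegSqLE B κ) :
    ∃ P : ℂ[X], P ≠ 0 ∧ P.natDegree ≤ κ ∧ ∀ v, 0 ≤ (B (aeval T P v) (aeval T P v)).re := by
  classical
  set S : Set (Fin (κ + 1) → ℂ) := Metric.sphere 0 1 with hSdef
  set K : Finset V → Set (Fin (κ + 1) → ℂ) := fun s =>
    S ∩ {c | ∀ v ∈ s, 0 ≤ (B (aeval T (toPoly c) v) (aeval T (toPoly c) v)).re} with hKdef
  have hS : IsCompact S := isCompact_sphere 0 1
  have hcl : ∀ s, IsClosed (K s) := by
    intro s
    apply IsClosed.inter Metric.isClosed_sphere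
    have : {c : Fin (κ + 1) → ℂ | ∀ v ∈ s, 0 ≤ (B (aeval T (toPoly c) v) (aeval T (toPoly c) v)).re}
        = ⋂ v ∈ s, {c | 0 ≤ (B (aeval T (toPoly c) v) (aeval T (toPoly c) v)).re} := by
      ext c
      simp
    rw [this]
    exact isClosed_biInter fun v _ => isClosed_le continuous_const (continuous_quadForm T v)
  have hcpt : ∀ s, IsCompact (K s) := fun s =>
    hS.of_isClosed_subset (hcl s) Set.inter_subset_left
  have hne : ∀ s, (K s).Nonempty := by
    intro s
    obtain ⟨P, hP0, hPdeg, hP⟩ := exists_poly_finset hB hT h s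
    set c : Fin (κ + 1) → ℂ := fun j => P.coeff j with hcdef
    have hc : toPoly c = P := by
      ext n
      by_cases hn : n < κ + 1
      · exact coeff_toPoly c ⟨n, hn⟩
      · rw [coeff_eq_zero_of_natDegree_lt (lt_of_le_of_lt (natDegree_toPoly_le c) (by omega)),
          coeff_eq_zero_of_natDegree_lt (lt_of_le_of_lt hPdeg (by omega))]
    have hc0 : c ≠ 0 := fun h0 => hP0 (by rw [← hc, h0]; exact (toPoly_eq_zero_iff _).2 rfl)
    have hnorm : ‖c‖ ≠ 0 := norm_ne_zero_iff.2 hc0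
    refine ⟨((‖c‖⁻¹ : ℝ) : ℂ) • c, ?_, ?_⟩
    · rw [hSdef, mem_sphere_zero_iff_norm, norm_smul, Complex.norm_real, norm_inv, norm_norm,
        inv_mul_cancel₀ hnorm]
    · intro v hv
      rw [toPoly_smul, hc, map_mul, aeval_C, Module.End.mul_apply,
        Module.algebraMap_end_apply, LinearMap.map_smulₛₗ₂, map_smul, smul_eq_mul, smul_eq_mul,
        ← mul_assoc, ← Complex.normSq_eq_conj_mul_self, Complex.re_ofReal_mul]
      exact mul_nonneg (Complex.normSq_nonneg _) (hP v hv)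
  have hdir : Directed (· ⊇ ·) K := by
    intro s₁ s₂
    refine ⟨s₁ ∪ s₂, ?_, ?_⟩
    · intro c hc
      exact ⟨hc.1, fun v hv => hc.2 v (Finset.mem_union_left _ hv)⟩
    · intro c hc
      exact ⟨hc.1, fun v hv => hc.2 v (Finset.mem_union_right _ hv)⟩
  obtain ⟨c, hc⟩ :=
    IsCompact.nonempty_iInter_of_directed_nonempty_isCompact_isClosed K hdir hne hcpt hcl
  rw [Set.mem_iInter] at hc
  have hcS : c ∈ S := (hc ∅).1
  have hc0 : c ≠ 0 := by
    intro h0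
    rw [h0, hSdef, mem_sphere_zero_iff_norm, norm_zero] at hcS
    exact zero_ne_one hcS
  refine ⟨toPoly c, fun h0 => hc0 ((toPoly_eq_zero_iff c).1 h0), natDegree_toPoly_le c,
    fun v => ?_⟩
  exact (hc {v}).2 v (Finset.mem_singleton_self v)

/-- Powers of a symmetric operator are symmetric. [folklore] -/
theorem IsSymOp.pow_left {T : V →ₗ[ℂ] V} (hT : IsSymOp B T) (j : ℕ) (x y : V) :
    B ((T ^ j) x) y = B x ((T ^ j) y) := by
  induction j generalizing x y with
  | zero => simp
  | succ j ih =>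
    have h1 : (T ^ (j + 1)) x = T ((T ^ j) x) := by rw [pow_succ', Module.End.mul_apply]
    have h2 : (T ^ (j + 1)) y = (T ^ j) (T y) := by rw [pow_succ, Module.End.mul_apply]
    rw [h1, h2, hT, ih]

/-- Normalised version of the algebraic definitization theorem: the coefficient vector may be
taken on the unit sphere. [folklore] -/
theorem abs_definitization_sphere (hB : B.IsSymm) {T : V →ₗ[ℂ] V} (hT : IsSymOp B T) {κ : ℕ}
    (h : NegSqLE B κ) :
    ∃ c : Fin (κ + 1) → ℂ, c ∈ Metric.sphere (0 : Fin (κ + 1) → ℂ) 1 ∧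
      ∀ v, 0 ≤ (B (aeval T (toPoly c) v) (aeval T (toPoly c) v)).re := by
  obtain ⟨P, hP0, hPdeg, hP⟩ := abs_definitization hB hT h
  set c : Fin (κ + 1) → ℂ := fun j => P.coeff j with hcdef
  have hc : toPoly c = P := by
    ext n
    by_cases hn : n < κ + 1
    · exact coeff_toPoly c ⟨n, hn⟩
    · rw [coeff_eq_zero_of_natDegree_lt (lt_of_le_of_lt (natDegree_toPoly_le c) (by omega)),
        coeff_eq_zero_of_natDegree_lt (lt_of_le_of_lt hPdeg (by omega))]
  have hc0 : c ≠ 0 := fun h0 => hP0 (by rw [← hc, h0]; exact (toPoly_eq_zero_iff _).2 rfl)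
  have hnorm : ‖c‖ ≠ 0 := norm_ne_zero_iff.2 hc0
  refine ⟨((‖c‖⁻¹ : ℝ) : ℂ) • c, ?_, ?_⟩
  · rw [mem_sphere_zero_iff_norm, norm_smul, Complex.norm_real, norm_inv, norm_norm,
      inv_mul_cancel₀ hnorm]
  · intro v
    rw [toPoly_smul, hc, map_mul, aeval_C, Module.End.mul_apply,
      Module.algebraMap_end_apply, LinearMap.map_smulₛₗ₂, map_smul, smul_eq_mul, smul_eq_mul,
      ← mul_assoc, ← Complex.normSq_eq_conj_mul_self, Complex.re_ofReal_mul]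
    exact mul_nonneg (Complex.normSq_nonneg _) (hP v)

/-- Expansion of `B (S v) (S v)` for a linear combination `v` (indices swapped). [folklore] -/
theorem apply_lin_sum_swap (S : V →ₗ[ℂ] V) {n : ℕ} (c : Fin n → ℂ) (u : Fin n → V) :
    B (S (∑ k, c k • u k)) (S (∑ l, c l • u l))
      = ∑ k, ∑ l, c k * conj (c l) * B (S (u l)) (S (u k)) := by
  have aux : B (∑ k, S (c k • u k)) (∑ l, S (c l • u l))
      = ∑ k, ∑ l, conj (c k) * c l * B (S (u k)) (S (u l)) := by
    simp_rw [map_smul S]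
    rw [apply_sum_smul]
    refine Finset.sum_congr rfl fun k _ => ?_
    rw [apply_right_sum_smul, Finset.mul_sum]
    refine Finset.sum_congr rfl fun l _ => ?_
    ring
  rw [map_sum S, aux, Finset.sum_comm]
  refine Finset.sum_congr rfl fun k _ => ?_
  refine Finset.sum_congr rfl fun l _ => ?_
  ring

/-- Expansion of `B (P(T)y) (P(T)y')` in the coefficients (indices swapped). [folklore] -/
theorem apply_aeval_toPoly₂ {T : V →ₗ[ℂ] V} (hT : IsSymOp B T) {κ : ℕ} (a : Fin (κ + 1) → ℂ)
    (y y' : V) : B (aeval T (toPoly a) y) (aeval T (toPoly a) y')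
      = ∑ j : Fin (κ + 1), ∑ m : Fin (κ + 1),
          a j * conj (a m) * B y ((T ^ ((j : ℕ) + (m : ℕ))) y') := by
  rw [aeval_toPoly_apply, aeval_toPoly_apply, apply_sum_smul]
  simp_rw [apply_right_sum_smul]
  rw [Finset.sum_comm]
  refine Finset.sum_congr rfl fun j _ => ?_
  rw [Finset.mul_sum]
  refine Finset.sum_congr rfl fun m _ => ?_
  rw [hT.pow_left, ← Module.End.mul_apply, ← pow_add, add_comm]
  ring

/-- Double sums over `Fin K` versus `Finset.range K`. [folklore] -/
theorem sum_fin_fin_eq_range {M : Type*} [AddCommMonoid M] (K : ℕ) (f : ℕ → ℕ → M) :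
    ∑ j : Fin K, ∑ m : Fin K, f j m = ∑ j ∈ Finset.range K, ∑ m ∈ Finset.range K, f j m := by
  have h : ∀ j : ℕ, ∑ m : Fin K, f j m = ∑ m ∈ Finset.range K, f j m := fun j =>
    Fin.sum_univ_eq_sum_range (f j) K
  simp_rw [h]
  exact Fin.sum_univ_eq_sum_range (fun j => ∑ m ∈ Finset.range K, f j m) K

/-- Coefficient bookkeeping: the double sum over `range (natDegree + 1)` of `toPoly a` equals the
double sum over `Fin (κ+1)` with the coefficient vector `a`. [folklore] -/
theorem coeff_sum_toPoly {κ : ℕ} (a : Fin (κ + 1) → ℂ) (E : ℕ → ℂ) :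
    ∑ j ∈ Finset.range ((toPoly a).natDegree + 1), ∑ m ∈ Finset.range ((toPoly a).natDegree + 1),
        (toPoly a).coeff j * conj ((toPoly a).coeff m) * (-Complex.I) ^ (j + m) * E (j + m)
      = ∑ j : Fin (κ + 1), ∑ m : Fin (κ + 1),
          a j * conj (a m) * (-Complex.I) ^ ((j : ℕ) + (m : ℕ)) * E (j + m) := by
  have hsub : Finset.range ((toPoly a).natDegree + 1) ⊆ Finset.range (κ + 1) :=
    Finset.range_mono (Nat.succ_le_succ (natDegree_toPoly_le a))
  have hzero : ∀ j, j ∉ Finset.range ((toPoly a).natDegree + 1) → (toPoly a).coeff j = 0 := by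
    intro j hj
    apply coeff_eq_zero_of_natDegree_lt
    rw [Finset.mem_range, not_lt] at hj
    omega
  rw [Finset.sum_subset hsub (fun j _ hj => by simp [hzero j hj])]
  have hinner : ∀ j, ∑ m ∈ Finset.range ((toPoly a).natDegree + 1),
      (toPoly a).coeff j * conj ((toPoly a).coeff m) * (-Complex.I) ^ (j + m) * E (j + m)
      = ∑ m ∈ Finset.range (κ + 1),
      (toPoly a).coeff j * conj ((toPoly a).coeff m) * (-Complex.I) ^ (j + m) * E (j + m) :=
    fun j => Finset.sum_subset hsub (fun m _ hm => by simp [hzero m hm])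
  simp_rw [hinner]
  rw [← sum_fin_fin_eq_range (κ + 1) (fun j m =>
    (toPoly a).coeff j * conj ((toPoly a).coeff m) * (-Complex.I) ^ (j + m) * E (j + m))]
  refine Finset.sum_congr rfl fun j _ => Finset.sum_congr rfl fun m _ => ?_
  rw [coeff_toPoly, coeff_toPoly]

end Literature.Analysis.OperatorTheory.KreinStewart
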